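import Mathlib
import Summits.ResolutionOfSingularities.ResolutionOfSingularities.Theorems.WeightedInvariantLocalWeightedDropTOT2BranchBirational

/-!
# TOT2-LINE (P3): THE COMAP ALONG A MONOMIAL CHART IS INJECTIVE ON ONE-DIMENSIONAL PRIMES MISSING THE EXCEPTIONAL VARIABLE
# (`comap_chartOne/chartTwo/chartDivOne/chartDivTwo_injective` — the hypothesis `hinj` of the B6 step theorems)

Sub-problem `ResolutionOfSingularities`, ENGINE crux `stmt-ResolutionOfSingularities-8899` (`LocalWeightedDrop`), skeleton v35 (2e806da509994632),
registered stub `stub_conflictBudget` (P3); menu item (M-o) `hinj` of res-L1-w43-stub-2 g6's B6 steps (WANT-HAND 2026-08-27T20:54:56Z, exact target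
below; this hand res-L1-w43-stub-1 g7).  [OURS · L1 W4.3 · chain w43.  Engine bookkeeping: nothing here is a statement of any manuscript;
AI-produced, gate-checked, weaker than expert review.  «[OURS · L1 W4.3] replaces the role of nothing printed; NOT a statement of the manuscript.»]

For a `k`-algebra endomorphism `Φ` of `R₃ = k⟦X₀,X₁,X₂⟧` and a PROPER ideal `I` with `𝔪^N ⊆ I + Φ(𝔪)R₃`:
* `exists_sum_sub_mem` — **every series is, modulo `I`, a finite combination `Σ_{|m|<N} Φ(d_m) · X^m`** (complete Nakayama, Matsumura 8.4, over
  `R₃ ⧸ Φ⁻¹I` — the finiteness half of `quotientMap_finite_birational`, for non-prime `I`);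
for a MONOMIAL CHART (`Φ` fixes `X j` and multiplies every variable by `1` or `X j`: the four charts `(u₁,u₁u₂,u₁y)`, `(u₁u₂,u₂,u₂y)`, `(u₁,u₂,u₁y)`,
`(u₁,u₂,u₂y)`):
* `exists_pow_mul_monomial_eq_map` — `(X j)^{|m|+…} · X^m ∈ Φ(R₃)` exactly; hence `exists_pow_mul_sub_map_mem`: `(X j)^N · x ≡ Φ(G) (mod I)`;
* **`eq_of_comap_eq_of_monomialChart`** — for one-dimensional primes `P′, Q′ ∌ X j`: `Φ⁻¹P′ = Φ⁻¹Q′ ⇒ P′ = Q′` (apply the above to `I = P′ ∩ Q′`,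
  whose jets are controlled by `(P′ + (X j))(Q′ + (X j)) ⊆ (P′ ∩ Q′) + (X j)`: `f ∈ P′ ⇒ Φ G ∈ P′ ⇒ G ∈ Φ⁻¹Q′ ⇒ (X j)^N f ∈ Q′ ⇒ f ∈ Q′`);
* the four named instances `comap_chartOne_injective`, `comap_chartTwo_injective`, `comap_chartDivOne_injective`, `comap_chartDivTwo_injective`
  (stub-2's exact target, `Φ = substAlgHom ha` of the literal families, any `ha`) and `eq_of_comap_eq_of_substAlgHom`.
-/

set_option linter.dupNamespace false -- mandated namespace of this single-conjunct summit

noncomputable section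

namespace Summit.ResolutionOfSingularities.ResolutionOfSingularities.Theorems

namespace TOT2Branch

open MvPowerSeries IsLocalRing

variable {k : Type} [Field k]

/-! ## Finiteness modulo a proper ideal along an endomorphism (complete Nakayama) -/

/-- **`R₃ ⧸ I = Σ_{|m|<N} (R₃ ⧸ Φ⁻¹I) · X^m`** for a proper ideal `I` with `𝔪^N ⊆ I + Φ(𝔪)R₃`: every `x ∈ R₃` is congruent modulo `I` to a finite
combination `Σ_{|m|<N} Φ(d_m) · X^m`. -/
theorem exists_sum_sub_mem (c : MvPowerSeries (Fin 3) k →ₐ[k] MvPowerSeries (Fin 3) k) {I : Ideal (MvPowerSeries (Fin 3) k)} (hI : I ≠ ⊤)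
    {N : ℕ} (hprim : maximalIdeal (MvPowerSeries (Fin 3) k) ^ N ≤ I ⊔ (maximalIdeal (MvPowerSeries (Fin 3) k)).map c)
    (x : MvPowerSeries (Fin 3) k) :
    ∃ d : (Fin 3 →₀ ℕ) → MvPowerSeries (Fin 3) k,
      x - ∑ e ∈ (Finsupp.finite_of_degree_lt (σ := Fin 3) N).toFinset, c (d e) * monomial e (1 : k) ∈ I := by
  classical
  set P : Ideal (MvPowerSeries (Fin 3) k) := I.comap (c : MvPowerSeries (Fin 3) k →+* MvPowerSeries (Fin 3) k) with hPdef
  have hP : P ≠ ⊤ := Ideal.comap_ne_top _ hI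
  set φ : MvPowerSeries (Fin 3) k ⧸ P →+* MvPowerSeries (Fin 3) k ⧸ I :=
    Ideal.quotientMap I (c : MvPowerSeries (Fin 3) k →+* MvPowerSeries (Fin 3) k) le_rfl with hφdef
  have hφmk : ∀ f : MvPowerSeries (Fin 3) k, φ (Ideal.Quotient.mk P f) = Ideal.Quotient.mk I (c f) := fun f => Ideal.quotientMap_mk
  haveI : IsNoetherianRing (MvPowerSeries (Fin 3) k) := Literature.AlgebraicGeometry.Resolution.isNoetherianRing_mvPowerSeries k (Fin 3)
  haveI : Nontrivial (MvPowerSeries (Fin 3) k ⧸ P) := Ideal.Quotient.nontrivial_iff.mpr hP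
  haveI : Nontrivial (MvPowerSeries (Fin 3) k ⧸ I) := Ideal.Quotient.nontrivial_iff.mpr hI
  haveI : IsLocalRing (MvPowerSeries (Fin 3) k ⧸ P) := IsLocalRing.of_surjective' (Ideal.Quotient.mk P) Ideal.Quotient.mk_surjective
  haveI : IsLocalRing (MvPowerSeries (Fin 3) k ⧸ I) := IsLocalRing.of_surjective' (Ideal.Quotient.mk I) Ideal.Quotient.mk_surjective
  haveI : IsAdicComplete (maximalIdeal (MvPowerSeries (Fin 3) k)) (MvPowerSeries (Fin 3) k) := isAdicComplete_maximalIdeal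
  haveI : IsAdicComplete (maximalIdeal (MvPowerSeries (Fin 3) k ⧸ P)) (MvPowerSeries (Fin 3) k ⧸ P) :=
    Literature.AlgebraicGeometry.Resolution.isAdicComplete_quotient P
  haveI : IsAdicComplete (maximalIdeal (MvPowerSeries (Fin 3) k ⧸ I)) (MvPowerSeries (Fin 3) k ⧸ I) :=
    Literature.AlgebraicGeometry.Resolution.isAdicComplete_quotient I
  letI : Algebra (MvPowerSeries (Fin 3) k ⧸ P) (MvPowerSeries (Fin 3) k ⧸ I) := φ.toAlgebra
  have halg : ∀ d : MvPowerSeries (Fin 3) k ⧸ P, algebraMap (MvPowerSeries (Fin 3) k ⧸ P) (MvPowerSeries (Fin 3) k ⧸ I) d = φ d := fun _ => rfl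
  -- `𝔪_D · (R₃ ⧸ I) = (Φ(𝔪) R₃) mod I`
  have hmapeq : (maximalIdeal (MvPowerSeries (Fin 3) k ⧸ P)).map (algebraMap (MvPowerSeries (Fin 3) k ⧸ P) (MvPowerSeries (Fin 3) k ⧸ I)) =
      ((maximalIdeal (MvPowerSeries (Fin 3) k)).map c).map (Ideal.Quotient.mk I) := by
    rw [← IsLocalRing.map_maximalIdeal_of_surjective (Ideal.Quotient.mk P) Ideal.Quotient.mk_surjective, Ideal.map_map]
    have hcm : (algebraMap (MvPowerSeries (Fin 3) k ⧸ P) (MvPowerSeries (Fin 3) k ⧸ I)).comp (Ideal.Quotient.mk P) =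
        (Ideal.Quotient.mk I).comp (c : MvPowerSeries (Fin 3) k →+* MvPowerSeries (Fin 3) k) := by
      rw [RingHom.algebraMap_toAlgebra]; exact Ideal.quotientMap_comp_mk le_rfl
    show _ = Ideal.map (Ideal.Quotient.mk I) (Ideal.map (c : MvPowerSeries (Fin 3) k →+* MvPowerSeries (Fin 3) k) (maximalIdeal (MvPowerSeries (Fin 3) k)))
    rw [Ideal.map_map, hcm]
  -- generators and the classes of `𝔪^N`
  let T : Finset (MvPowerSeries (Fin 3) k ⧸ I) :=
    (Finsupp.finite_of_degree_lt (σ := Fin 3) N).toFinset.image fun e => Ideal.Quotient.mk I (monomial e (1 : k))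
  have hpowN : ∀ r : MvPowerSeries (Fin 3) k, r ∈ maximalIdeal (MvPowerSeries (Fin 3) k) ^ N →
      Ideal.Quotient.mk I r ∈ ((maximalIdeal (MvPowerSeries (Fin 3) k ⧸ P)) • (⊤ : Submodule (MvPowerSeries (Fin 3) k ⧸ P) (MvPowerSeries (Fin 3) k ⧸ I))) := by
    intro r hr
    rw [Ideal.smul_top_eq_map, Submodule.restrictScalars_mem, hmapeq]
    obtain ⟨p', hp', w, hw, rfl⟩ := Submodule.mem_sup.mp (hprim hr)
    rw [map_add, Ideal.Quotient.eq_zero_iff_mem.mpr hp', zero_add]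
    exact Ideal.mem_map_of_mem _ hw
  have hsup : Submodule.span (MvPowerSeries (Fin 3) k ⧸ P) (T : Set (MvPowerSeries (Fin 3) k ⧸ I)) ⊔
      ((maximalIdeal (MvPowerSeries (Fin 3) k ⧸ P)) • (⊤ : Submodule (MvPowerSeries (Fin 3) k ⧸ P) (MvPowerSeries (Fin 3) k ⧸ I))) = ⊤ := by
    refine Submodule.eq_top_iff'.mpr fun z => ?_
    obtain ⟨f, rfl⟩ := Ideal.Quotient.mk_surjective z
    have hsplit : f = ((truncTotal N f : MvPolynomial (Fin 3) k) : MvPowerSeries (Fin 3) k) + (f - (truncTotal N f : MvPolynomial (Fin 3) k)) := by ring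
    rw [hsplit, map_add]
    refine Submodule.add_mem_sup ?_ (hpowN _ (Literature.RingTheory.MvPowerSeries.Jets.sub_coe_truncTotal_mem_maximalIdeal_pow N f))
    rw [(truncTotal N f).as_sum, ← MvPolynomial.coeToMvPowerSeries.ringHom_apply, map_sum, map_sum]
    refine Submodule.sum_mem _ fun e he => ?_
    have hedeg : e.degree < N := by
      by_contra hN'
      simp only [not_lt] at hN'
      exact (MvPolynomial.mem_support_iff.1 he) (coeff_truncTotal_eq_zero _ hN')
    have hmono : MvPolynomial.monomial e ((truncTotal N f).coeff e) =
        MvPolynomial.C ((truncTotal N f).coeff e) * MvPolynomial.monomial e (1 : k) := by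
      rw [MvPolynomial.C_mul_monomial, mul_one]
    rw [MvPolynomial.coeToMvPowerSeries.ringHom_apply, hmono, MvPolynomial.coe_mul, MvPolynomial.coe_C, map_mul,
      ← algHom_C' c, ← hφmk, ← halg, ← Algebra.smul_def, MvPolynomial.coe_monomial]
    refine Submodule.smul_mem _ _ (Submodule.subset_span ?_)
    rw [Finset.mem_coe]
    exact Finset.mem_image.mpr ⟨e, by simpa using hedeg, rfl⟩
  -- separatedness and Nakayama
  have hloc : (maximalIdeal (MvPowerSeries (Fin 3) k ⧸ P)).map (algebraMap (MvPowerSeries (Fin 3) k ⧸ P) (MvPowerSeries (Fin 3) k ⧸ I)) ≤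
      maximalIdeal (MvPowerSeries (Fin 3) k ⧸ I) := by
    rw [hmapeq, ← IsLocalRing.map_maximalIdeal_of_surjective (Ideal.Quotient.mk I) Ideal.Quotient.mk_surjective]
    refine Ideal.map_mono ?_
    rw [Ideal.map_le_iff_le_comap]
    intro g hg
    exact Literature.RingTheory.MvPowerSeries.Jets.algHom_apply_mem_maximalIdeal c hg
  haveI : IsHausdorff (maximalIdeal (MvPowerSeries (Fin 3) k ⧸ P)) (MvPowerSeries (Fin 3) k ⧸ I) := by
    refine ⟨fun x hx => IsHausdorff.haus
      ‹IsAdicComplete (maximalIdeal (MvPowerSeries (Fin 3) k ⧸ I)) (MvPowerSeries (Fin 3) k ⧸ I)›.toIsHausdorff x fun n => ?_⟩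
    have hxn := hx n
    rw [SModEq.zero] at hxn ⊢
    rw [Ideal.smul_top_eq_map, Submodule.restrictScalars_mem, Ideal.map_pow] at hxn
    rw [smul_eq_mul, Ideal.mul_top]
    exact Ideal.pow_right_mono hloc n hxn
  have htop := Literature.AlgebraicGeometry.Resolution.Matsumura1987_8_4_finset (maximalIdeal (MvPowerSeries (Fin 3) k ⧸ P)) T hsup
  -- read off representatives of the coefficients
  let S : Submodule (MvPowerSeries (Fin 3) k ⧸ P) (MvPowerSeries (Fin 3) k ⧸ I) :=
    { carrier := {z | ∃ d : (Fin 3 →₀ ℕ) → MvPowerSeries (Fin 3) k,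
        z = Ideal.Quotient.mk I (∑ e ∈ (Finsupp.finite_of_degree_lt (σ := Fin 3) N).toFinset, c (d e) * monomial e (1 : k))}
      zero_mem' := ⟨0, by simp⟩
      add_mem' := by
        rintro _ _ ⟨d₁, rfl⟩ ⟨d₂, rfl⟩
        refine ⟨d₁ + d₂, ?_⟩
        rw [← map_add, ← Finset.sum_add_distrib]
        congr 1
        exact Finset.sum_congr rfl fun e _ => by rw [Pi.add_apply, map_add, add_mul]
      smul_mem' := by
        rintro δ _ ⟨d, rfl⟩
        obtain ⟨r, rfl⟩ := Ideal.Quotient.mk_surjective δ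
        refine ⟨fun e => r * d e, ?_⟩
        rw [Algebra.smul_def, halg, hφmk, ← map_mul, Finset.mul_sum]
        congr 1
        exact Finset.sum_congr rfl fun e _ => by rw [map_mul, mul_assoc] }
  have hTS : (T : Set (MvPowerSeries (Fin 3) k ⧸ I)) ⊆ S := fun t ht => by
    rw [Finset.mem_coe] at ht
    obtain ⟨e, he, rfl⟩ := Finset.mem_image.mp ht
    refine ⟨Pi.single e 1, ?_⟩
    rw [Finset.sum_eq_single e (fun e' _ he' => by rw [Pi.single_eq_of_ne he', map_zero, zero_mul]) (fun h => absurd he h),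
      Pi.single_eq_same, map_one c, one_mul]
  have hz : Ideal.Quotient.mk I x ∈ S := (Submodule.span_le.mpr hTS) (by rw [htop]; exact Submodule.mem_top)
  obtain ⟨d, hd⟩ := hz
  exact ⟨d, by rw [← Ideal.Quotient.eq]; exact hd⟩

/-! ## Monomial charts: `(X j)^N · X^m` lies in the image exactly -/

/-- A monomial as the product of the powers of the three variables. -/
theorem monomial_one_eq_prod (e : Fin 3 →₀ ℕ) :
    (monomial e (1 : k) : MvPowerSeries (Fin 3) k) = X 0 ^ e 0 * X 1 ^ e 1 * X 2 ^ e 2 := by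
  have he : e = Finsupp.single 0 (e 0) + Finsupp.single 1 (e 1) + Finsupp.single 2 (e 2) := by
    ext i
    fin_cases i <;> simp
  conv_lhs => rw [he]
  rw [X_pow_eq, X_pow_eq, X_pow_eq, monomial_mul_monomial, monomial_mul_monomial, mul_one, mul_one]

/-- **Monomials under a monomial chart**: `Φ(X^m) = (X j)^n · X^m` with `n ≤ |m|`. -/
theorem exists_map_monomial_eq (Φ : MvPowerSeries (Fin 3) k →ₐ[k] MvPowerSeries (Fin 3) k) (j : Fin 3)
    (hmon : ∀ i : Fin 3, Φ (X i) = X i ∨ Φ (X i) = X j * X i) (e : Fin 3 →₀ ℕ) :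
    ∃ n ≤ e.degree, Φ (monomial e (1 : k)) = X j ^ n * monomial e (1 : k) := by
  have hX : ∀ i : Fin 3, ∃ n ≤ e i, Φ (X i) ^ e i = X j ^ n * X i ^ e i := fun i => by
    rcases hmon i with h | h
    · exact ⟨0, Nat.zero_le _, by rw [h, pow_zero, one_mul]⟩
    · exact ⟨e i, le_rfl, by rw [h, mul_pow]⟩
  obtain ⟨n₀, h₀, e₀⟩ := hX 0
  obtain ⟨n₁, h₁, e₁⟩ := hX 1
  obtain ⟨n₂, h₂, e₂⟩ := hX 2
  refine ⟨n₀ + n₁ + n₂, ?_, ?_⟩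
  · rw [Finsupp.degree_eq_sum, Fin.sum_univ_three]; omega
  · rw [monomial_one_eq_prod, map_mul, map_mul, map_pow, map_pow, map_pow, e₀, e₁, e₂]
    ring

/-- `(X j)^N · X^m = Φ((X j)^{N−n} · X^m)` for `N ≥ |m|`. -/
theorem exists_pow_mul_monomial_eq_map (Φ : MvPowerSeries (Fin 3) k →ₐ[k] MvPowerSeries (Fin 3) k) (j : Fin 3) (hfix : Φ (X j) = X j)
    (hmon : ∀ i : Fin 3, Φ (X i) = X i ∨ Φ (X i) = X j * X i) (e : Fin 3 →₀ ℕ) {N : ℕ} (hN : e.degree ≤ N) :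
    ∃ g : MvPowerSeries (Fin 3) k, (X j : MvPowerSeries (Fin 3) k) ^ N * monomial e (1 : k) = Φ g := by
  obtain ⟨n, hn, he⟩ := exists_map_monomial_eq Φ j hmon e
  refine ⟨X j ^ (N - n) * monomial e 1, ?_⟩
  rw [map_mul, map_pow, hfix, he, ← mul_assoc, ← pow_add, Nat.sub_add_cancel (hn.trans hN)]

/-- **`(X j)^N · x ≡ Φ(G) (mod I)`** for a monomial chart `Φ` and a proper ideal `I` with `𝔪^N ⊆ I + Φ(𝔪)R₃`. -/
theorem exists_pow_mul_sub_map_mem (Φ : MvPowerSeries (Fin 3) k →ₐ[k] MvPowerSeries (Fin 3) k) (j : Fin 3) (hfix : Φ (X j) = X j)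
    (hmon : ∀ i : Fin 3, Φ (X i) = X i ∨ Φ (X i) = X j * X i) {I : Ideal (MvPowerSeries (Fin 3) k)} (hI : I ≠ ⊤)
    {N : ℕ} (hprim : maximalIdeal (MvPowerSeries (Fin 3) k) ^ N ≤ I ⊔ (maximalIdeal (MvPowerSeries (Fin 3) k)).map Φ)
    (x : MvPowerSeries (Fin 3) k) :
    ∃ G : MvPowerSeries (Fin 3) k, (X j : MvPowerSeries (Fin 3) k) ^ N * x - Φ G ∈ I := by
  classical
  obtain ⟨d, hd⟩ := exists_sum_sub_mem Φ hI hprim x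
  have hg : ∀ e : Fin 3 →₀ ℕ, ∃ g : MvPowerSeries (Fin 3) k,
      e ∈ (Finsupp.finite_of_degree_lt (σ := Fin 3) N).toFinset → (X j : MvPowerSeries (Fin 3) k) ^ N * monomial e (1 : k) = Φ g := by
    intro e
    by_cases he : e ∈ (Finsupp.finite_of_degree_lt (σ := Fin 3) N).toFinset
    · have hdeg : e.degree < N := by simpa using he
      obtain ⟨g, hg⟩ := exists_pow_mul_monomial_eq_map Φ j hfix hmon e hdeg.le
      exact ⟨g, fun _ => hg⟩
    · exact ⟨0, fun h => absurd h he⟩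
  choose g hg using hg
  refine ⟨∑ e ∈ (Finsupp.finite_of_degree_lt (σ := Fin 3) N).toFinset, d e * g e, ?_⟩
  have h1 := Ideal.mul_mem_left I ((X j : MvPowerSeries (Fin 3) k) ^ N) hd
  rw [mul_sub, Finset.mul_sum] at h1
  have h2 : ∑ e ∈ (Finsupp.finite_of_degree_lt (σ := Fin 3) N).toFinset, (X j : MvPowerSeries (Fin 3) k) ^ N * (Φ (d e) * monomial e (1 : k)) =
      Φ (∑ e ∈ (Finsupp.finite_of_degree_lt (σ := Fin 3) N).toFinset, d e * g e) := by
    rw [map_sum]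
    exact Finset.sum_congr rfl fun e he => by rw [map_mul, ← hg e he]; ring
  rwa [h2] at h1

/-! ## Injectivity of the comap on one-dimensional primes missing the exceptional variable -/

/-- `(P + S)(Q + S) ⊆ (P ∩ Q) + S` for ideals. -/
theorem sup_mul_sup_le {R : Type*} [CommRing R] (P Q S : Ideal R) : (P ⊔ S) * (Q ⊔ S) ≤ (P ⊓ Q) ⊔ S := by
  refine Ideal.mul_le.mpr fun m hm n hn => ?_
  obtain ⟨p, hp, s₁, hs₁, rfl⟩ := Submodule.mem_sup.mp hm
  obtain ⟨q, hq, s₂, hs₂, rfl⟩ := Submodule.mem_sup.mp hn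
  have h : (p + s₁) * (q + s₂) = p * q + (p * s₂ + s₁ * (q + s₂)) := by ring
  rw [h]
  exact Submodule.add_mem_sup ⟨Ideal.mul_mem_right _ _ hp, Ideal.mul_mem_left _ _ hq⟩
    (Ideal.add_mem _ (Ideal.mul_mem_left _ _ hs₂) (Ideal.mul_mem_right _ _ hs₁))

/-- One inclusion of the injectivity: along a monomial chart, `Φ⁻¹P′ = Φ⁻¹Q′` forces `P′ ⊆ Q′` for one-dimensional primes missing `X j`. -/
theorem le_of_comap_eq_of_monomialChart (Φ : MvPowerSeries (Fin 3) k →ₐ[k] MvPowerSeries (Fin 3) k) (j : Fin 3) (hfix : Φ (X j) = X j)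
    (hmon : ∀ i : Fin 3, Φ (X i) = X i ∨ Φ (X i) = X j * X i) {P' Q' : Ideal (MvPowerSeries (Fin 3) k)} (hP : P'.IsPrime) (hQ : Q'.IsPrime)
    (hdP : ringKrullDim (MvPowerSeries (Fin 3) k ⧸ P') = 1) (hdQ : ringKrullDim (MvPowerSeries (Fin 3) k ⧸ Q') = 1)
    (hXP : (X j : MvPowerSeries (Fin 3) k) ∉ P') (hXQ : (X j : MvPowerSeries (Fin 3) k) ∉ Q') (h : P'.comap Φ = Q'.comap Φ) :
    P' ≤ Q' := by
  haveI := hP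
  haveI := hQ
  -- the jets of `I = P′ ∩ Q′`
  obtain ⟨a, ha⟩ := exists_maximalIdeal_pow_le_sup_span hdP hXP
  obtain ⟨b, hb⟩ := exists_maximalIdeal_pow_le_sup_span hdQ hXQ
  have hI : P' ⊓ Q' ≠ ⊤ := ne_top_of_le_ne_top hP.ne_top inf_le_left
  have hXj : Ideal.span {(X j : MvPowerSeries (Fin 3) k)} ≤ (maximalIdeal (MvPowerSeries (Fin 3) k)).map Φ := by
    rw [Ideal.span_le, Set.singleton_subset_iff, SetLike.mem_coe, ← hfix]
    exact Ideal.mem_map_of_mem _ (Literature.AlgebraicGeometry.Resolution.X_mem_maximalIdeal k (Fin 3) j)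
  have hprim : maximalIdeal (MvPowerSeries (Fin 3) k) ^ (a + b) ≤ (P' ⊓ Q') ⊔ (maximalIdeal (MvPowerSeries (Fin 3) k)).map Φ := by
    rw [pow_add]
    exact (Ideal.mul_mono ha hb).trans ((sup_mul_sup_le _ _ _).trans (sup_le_sup_left hXj _))
  intro f hf
  obtain ⟨G, hG⟩ := exists_pow_mul_sub_map_mem Φ j hfix hmon hI hprim f
  have hGP : Φ G ∈ P' := by
    have h1 : (X j : MvPowerSeries (Fin 3) k) ^ (a + b) * f - ((X j : MvPowerSeries (Fin 3) k) ^ (a + b) * f - Φ G) ∈ P' :=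
      Ideal.sub_mem _ (Ideal.mul_mem_left _ _ hf) (inf_le_left (a := P') (b := Q') hG)
    rwa [sub_sub_cancel] at h1
  have hGQ : Φ G ∈ Q' := by
    have h1 : G ∈ P'.comap Φ := hGP
    rw [h] at h1
    exact h1
  have hXf : (X j : MvPowerSeries (Fin 3) k) ^ (a + b) * f ∈ Q' := by
    have h1 := Ideal.add_mem _ (inf_le_right (a := P') (b := Q') hG) hGQ
    rwa [sub_add_cancel] at h1
  rcases hQ.mem_or_mem hXf with h1 | h1
  · exact absurd (hQ.mem_of_pow_mem _ h1) hXQ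
  · exact h1

/-- **INJECTIVITY OF THE COMAP ALONG A MONOMIAL CHART** on one-dimensional primes missing the exceptional variable `X j`. -/
theorem eq_of_comap_eq_of_monomialChart (Φ : MvPowerSeries (Fin 3) k →ₐ[k] MvPowerSeries (Fin 3) k) (j : Fin 3) (hfix : Φ (X j) = X j)
    (hmon : ∀ i : Fin 3, Φ (X i) = X i ∨ Φ (X i) = X j * X i) {P' Q' : Ideal (MvPowerSeries (Fin 3) k)} (hP : P'.IsPrime) (hQ : Q'.IsPrime)
    (hdP : ringKrullDim (MvPowerSeries (Fin 3) k ⧸ P') = 1) (hdQ : ringKrullDim (MvPowerSeries (Fin 3) k ⧸ Q') = 1)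
    (hXP : (X j : MvPowerSeries (Fin 3) k) ∉ P') (hXQ : (X j : MvPowerSeries (Fin 3) k) ∉ Q') (h : P'.comap Φ = Q'.comap Φ) :
    P' = Q' :=
  le_antisymm (le_of_comap_eq_of_monomialChart Φ j hfix hmon hP hQ hdP hdQ hXP hXQ h)
    (le_of_comap_eq_of_monomialChart Φ j hfix hmon hQ hP hdQ hdP hXQ hXP h.symm)

/-- The same for a monomial SUBSTITUTION `a` (`a j = X j`, `a i ∈ {X i, X j · X i}`). -/
theorem eq_of_comap_eq_of_substAlgHom {a : Fin 3 → MvPowerSeries (Fin 3) k} (ha : HasSubst a) (j : Fin 3)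
    (hfix : a j = X j) (hmon : ∀ i : Fin 3, a i = X i ∨ a i = X j * X i) {P' Q' : Ideal (MvPowerSeries (Fin 3) k)}
    (hP : P'.IsPrime) (hQ : Q'.IsPrime)
    (hdP : ringKrullDim (MvPowerSeries (Fin 3) k ⧸ P') = 1) (hdQ : ringKrullDim (MvPowerSeries (Fin 3) k ⧸ Q') = 1)
    (hXP : (X j : MvPowerSeries (Fin 3) k) ∉ P') (hXQ : (X j : MvPowerSeries (Fin 3) k) ∉ Q')
    (h : P'.comap (substAlgHom ha : MvPowerSeries (Fin 3) k →ₐ[k] MvPowerSeries (Fin 3) k) =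
      Q'.comap (substAlgHom ha : MvPowerSeries (Fin 3) k →ₐ[k] MvPowerSeries (Fin 3) k)) : P' = Q' := by
  have hX : ∀ i, (substAlgHom ha : MvPowerSeries (Fin 3) k →ₐ[k] MvPowerSeries (Fin 3) k) (X i : MvPowerSeries (Fin 3) k) = a i :=
    fun i => by rw [substAlgHom_apply, subst_X ha]
  exact eq_of_comap_eq_of_monomialChart (substAlgHom ha : MvPowerSeries (Fin 3) k →ₐ[k] MvPowerSeries (Fin 3) k) j (by rw [hX, hfix])
    (fun i => by rw [hX]; exact hmon i) hP hQ hdP hdQ hXP hXQ h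

/-- **`hinj` for the `u₁`-CHART** `![X 0, X 0 * X 1, X 0 * X 2]` (exceptional variable `X 0`). -/
theorem comap_chartOne_injective (ha : HasSubst (![X 0, X 0 * X 1, X 0 * X 2] : Fin 3 → MvPowerSeries (Fin 3) k))
    {P' Q' : Ideal (MvPowerSeries (Fin 3) k)} (hP : P'.IsPrime) (hQ : Q'.IsPrime)
    (hdP : ringKrullDim (MvPowerSeries (Fin 3) k ⧸ P') = 1) (hdQ : ringKrullDim (MvPowerSeries (Fin 3) k ⧸ Q') = 1)
    (hXP : (X 0 : MvPowerSeries (Fin 3) k) ∉ P') (hXQ : (X 0 : MvPowerSeries (Fin 3) k) ∉ Q')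
    (h : P'.comap (substAlgHom ha : MvPowerSeries (Fin 3) k →ₐ[k] MvPowerSeries (Fin 3) k) =
      Q'.comap (substAlgHom ha : MvPowerSeries (Fin 3) k →ₐ[k] MvPowerSeries (Fin 3) k)) : P' = Q' :=
  eq_of_comap_eq_of_substAlgHom ha 0 (by simp) (fun i => by fin_cases i <;> simp) hP hQ hdP hdQ hXP hXQ h

/-- **`hinj` for the `u₂`-CHART** `![X 0 * X 1, X 1, X 1 * X 2]` (exceptional variable `X 1`). -/
theorem comap_chartTwo_injective (ha : HasSubst (![X 0 * X 1, X 1, X 1 * X 2] : Fin 3 → MvPowerSeries (Fin 3) k))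
    {P' Q' : Ideal (MvPowerSeries (Fin 3) k)} (hP : P'.IsPrime) (hQ : Q'.IsPrime)
    (hdP : ringKrullDim (MvPowerSeries (Fin 3) k ⧸ P') = 1) (hdQ : ringKrullDim (MvPowerSeries (Fin 3) k ⧸ Q') = 1)
    (hXP : (X 1 : MvPowerSeries (Fin 3) k) ∉ P') (hXQ : (X 1 : MvPowerSeries (Fin 3) k) ∉ Q')
    (h : P'.comap (substAlgHom ha : MvPowerSeries (Fin 3) k →ₐ[k] MvPowerSeries (Fin 3) k) =
      Q'.comap (substAlgHom ha : MvPowerSeries (Fin 3) k →ₐ[k] MvPowerSeries (Fin 3) k)) : P' = Q' :=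
  eq_of_comap_eq_of_substAlgHom ha 1 (by simp) (fun i => by fin_cases i <;> simp [mul_comm]) hP hQ hdP hdQ hXP hXQ h

/-- **`hinj` for the chart of the blow-up of `V(y, u₁)`** `![X 0, X 1, X 0 * X 2]` (exceptional variable `X 0`). -/
theorem comap_chartDivOne_injective (ha : HasSubst (![X 0, X 1, X 0 * X 2] : Fin 3 → MvPowerSeries (Fin 3) k))
    {P' Q' : Ideal (MvPowerSeries (Fin 3) k)} (hP : P'.IsPrime) (hQ : Q'.IsPrime)
    (hdP : ringKrullDim (MvPowerSeries (Fin 3) k ⧸ P') = 1) (hdQ : ringKrullDim (MvPowerSeries (Fin 3) k ⧸ Q') = 1)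
    (hXP : (X 0 : MvPowerSeries (Fin 3) k) ∉ P') (hXQ : (X 0 : MvPowerSeries (Fin 3) k) ∉ Q')
    (h : P'.comap (substAlgHom ha : MvPowerSeries (Fin 3) k →ₐ[k] MvPowerSeries (Fin 3) k) =
      Q'.comap (substAlgHom ha : MvPowerSeries (Fin 3) k →ₐ[k] MvPowerSeries (Fin 3) k)) : P' = Q' :=
  eq_of_comap_eq_of_substAlgHom ha 0 (by simp) (fun i => by fin_cases i <;> simp) hP hQ hdP hdQ hXP hXQ h

/-- **`hinj` for the chart of the blow-up of `V(y, u₂)`** `![X 0, X 1, X 1 * X 2]` (exceptional variable `X 1`). -/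
theorem comap_chartDivTwo_injective (ha : HasSubst (![X 0, X 1, X 1 * X 2] : Fin 3 → MvPowerSeries (Fin 3) k))
    {P' Q' : Ideal (MvPowerSeries (Fin 3) k)} (hP : P'.IsPrime) (hQ : Q'.IsPrime)
    (hdP : ringKrullDim (MvPowerSeries (Fin 3) k ⧸ P') = 1) (hdQ : ringKrullDim (MvPowerSeries (Fin 3) k ⧸ Q') = 1)
    (hXP : (X 1 : MvPowerSeries (Fin 3) k) ∉ P') (hXQ : (X 1 : MvPowerSeries (Fin 3) k) ∉ Q')
    (h : P'.comap (substAlgHom ha : MvPowerSeries (Fin 3) k →ₐ[k] MvPowerSeries (Fin 3) k) =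
      Q'.comap (substAlgHom ha : MvPowerSeries (Fin 3) k →ₐ[k] MvPowerSeries (Fin 3) k)) : P' = Q' :=
  eq_of_comap_eq_of_substAlgHom ha 1 (by simp) (fun i => by fin_cases i <;> simp) hP hQ hdP hdQ hXP hXQ h

end TOT2Branch

end Summit.ResolutionOfSingularities.ResolutionOfSingularities.Theorems

end
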